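import Literature.Probability.Percolation.TwoSetExchange
import Literature.Probability.Percolation.KozmaNitzanPreFKG
import HarnessLib

/-!
# `NoHeavyLowerTail` (stmt-CriticalPhenomena-4575) — the CONDITIONED CHAMPIONSHIP EXCHANGE (every level, every cell)

Support file (lemma factory #8 `prim-lf-8`, gen 7; `--supports stmt-CriticalPhenomena-4575`).  No definitions, no named facts,
no sorries.  `μ = prodBernoulli w` on `Fin n`, relays `A`, level `j`, `π(v) = {a ∈ A : v ↔ a}`, `R_v = {|π(v)| ≤ j}` ("`v` is light"),
`S(v) = μ(R_v)`; `c, x ∈ A` with `S(x) ≤ S(c)` (e.g. `c` a level-`j` champion).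

* `ConditionedChampionExchange.exchange_typePlus` — for EVERY event `E` of type `(+)` for the pair of clusters `(C_x, C_c)`
  (closed under enlarging `C_x` and shrinking `C_c`; e.g. `{o ↔ x}`, `{o ↔ x} ∩ {c ↮ Y}`):   **`μ(E ∩ R_x) ≤ μ(E ∩ R_c)`**.
  "Even given an attachment to `x` (and cuts at `c`), the champion is still at least as likely to be light as `x`."
  Proof: on `{x ↔ c}` the two blocks coincide; on `D = {x ↮ c}` the two-set exchange inequality (van den Berg–Häggström–Kahn
  2006, Thm. 1.5 / 2.1, tree `setTwoClusterExchange` with `S = {x}`, `T = {c}`) makes `E` positively correlated with the type-`(+)`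
  events `{|π(x)| > j}` and `{|π(c)| ≤ j}` given `D`, and championship restricted to `D` (`μ(D ∩ R_c) ≥ μ(D ∩ R_x)`, because the
  `{x ↔ c}`-parts of `S(x)` and `S(c)` agree) closes the chain.
* `conditionedChampionExchange` — the case `E = {o ↔ x}`:  `μ({o↔x} ∩ R_x) ≤ μ({o↔x} ∩ R_c)`;
  `conditionedChampionExchange_swap` — equivalently `μ(o↔x, x light, c heavy) ≤ μ(o↔x, x heavy, c light)`
  (the level-`j` exchange "swap the heavy block from the champion to the observer's relay");
* `momentExchange` — summing over `x ≠ c` at a champion: `Σ_{x≠c} μ(o↔x, x light, c heavy) ≤ Σ_{x≠c} μ(o↔x, x heavy, c light)`,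
  i.e. `E[N; 1 ≤ N ≤ j, |π(c)| > j] ≤ E[N; N > j, |π(c)| ≤ j]` (`N = |π(o)|`): the MOMENT form of the T-form cumulative isolation
  law XZ (`μ(1≤N≤j, c heavy) ≤ μ(N>j, c light)`, censused 0-violation, open from level 2), which it implies for observers whose
  small pockets are single relays (e.g. the top cell `j = |A|−2`) and which is the exchange behind the fragmented decomposition
  (CANDIDATES.md v8 B8, prim-lf-8 HOME).
-/

noncomputable section

namespace Summit.CriticalPhenomena.PercolationContinuityZ3.Theorems

open MeasureTheory Set Literature.Probability.LatticeModels Literature.Probability.Percolation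
open scoped Classical BigOperators

variable {n : ℕ}

namespace ConditionedChampionExchange

/-- The two-set separation event of the singletons `{x}`, `{c}` is `{x ↮ c}`. [folklore] -/
theorem sep_singletons_eq (x c : Fin n) :
    {ω : BondConfig (Fin n) | ∀ s ∈ ({x} : Set (Fin n)), ∀ t ∈ ({c} : Set (Fin n)), ¬ (openGraph ω).Reachable s t} =
      (openConn x c : Set (BondConfig (Fin n)))ᶜ := by
  ext ω
  simp only [mem_setOf_eq, mem_singleton_iff, forall_eq, mem_compl_iff]
  rfl

/-- On `{x ↔ c}` the relay blocks of `x` and `c` coincide. [folklore] -/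
theorem filter_eq_of_openConn (A : Finset (Fin n)) {ω : BondConfig (Fin n)} {x c : Fin n}
    (h : ω ∈ (openConn x c : Set (BondConfig (Fin n)))) :
    (A.filter fun a => ω ∈ openConn x a) = (A.filter fun a => ω ∈ openConn c a) := by
  have h' : (openGraph ω).Reachable x c := h
  ext a
  simp only [Finset.mem_filter, and_congr_right_iff]
  intro _
  change (openGraph ω).Reachable x a ↔ (openGraph ω).Reachable c a
  exact ⟨fun ha => h'.symm.trans ha, fun ha => h'.trans ha⟩

/-- `{|π(x)| > j}` is of type `(+)` for `(C_{{x}}, C_{{c}})` (it grows with the cluster of `x`). [folklore] -/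
theorem heavy_typePlus (A : Finset (Fin n)) (x c : Fin n) (j : ℕ) ⦃ω ω' : BondConfig (Fin n)⦄
    (hs : (⋃ s ∈ ({x} : Set (Fin n)), openEdgeCluster ω s) ⊆ (⋃ s ∈ ({x} : Set (Fin n)), openEdgeCluster ω' s))
    (ht : (⋃ t ∈ ({c} : Set (Fin n)), openEdgeCluster ω' t) ⊆ (⋃ t ∈ ({c} : Set (Fin n)), openEdgeCluster ω t))
    (h : ω ∈ {ω : BondConfig (Fin n) | j < (A.filter fun a => ω ∈ openConn x a).card}) :
    ω' ∈ {ω : BondConfig (Fin n) | j < (A.filter fun a => ω ∈ openConn x a).card} := by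
  simp only [mem_setOf_eq] at h ⊢
  refine lt_of_lt_of_le h (Finset.card_le_card fun a ha => ?_)
  simp only [Finset.mem_filter] at ha ⊢
  exact ⟨ha.1, TwoSetExchange.typePlus_openConn_of_mem ({x} : Set (Fin n)) ({c} : Set (Fin n))
    (mem_singleton x) a hs ht ha.2⟩

/-- `{|π(c)| ≤ j}` is of type `(+)` for `(C_{{x}}, C_{{c}})` (it grows as the cluster of `c` shrinks). [folklore] -/
theorem light_typePlus (A : Finset (Fin n)) (x c : Fin n) (j : ℕ) ⦃ω ω' : BondConfig (Fin n)⦄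
    (hs : (⋃ s ∈ ({x} : Set (Fin n)), openEdgeCluster ω s) ⊆ (⋃ s ∈ ({x} : Set (Fin n)), openEdgeCluster ω' s))
    (ht : (⋃ t ∈ ({c} : Set (Fin n)), openEdgeCluster ω' t) ⊆ (⋃ t ∈ ({c} : Set (Fin n)), openEdgeCluster ω t))
    (h : ω ∈ {ω : BondConfig (Fin n) | (A.filter fun a => ω ∈ openConn c a).card ≤ j}) :
    ω' ∈ {ω : BondConfig (Fin n) | (A.filter fun a => ω ∈ openConn c a).card ≤ j} := by
  simp only [mem_setOf_eq] at h ⊢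
  refine le_trans (Finset.card_le_card fun a ha => ?_) h
  simp only [Finset.mem_filter] at ha ⊢
  refine ⟨ha.1, ?_⟩
  by_contra hω
  exact TwoSetExchange.typePlus_not_openConn_of_mem ({x} : Set (Fin n)) ({c} : Set (Fin n))
    (mem_singleton c) a hs ht hω ha.2

/-- **Positive correlation of two type-`(+)` events given `{x ↮ c}`** (two-set exchange with trivial type-`(−)` events):
`μ(D ∩ E₁) · μ(D ∩ E₂) ≤ μ(D ∩ (E₁ ∩ E₂)) · μ(D)`, `D = {x ↮ c}`.
[cite: VandenbergHaggstromKahn2005, Thm. 1.5 (p. 7) / Thm. 2.1 (p. 9) at q = 1 — corollary] -/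
theorem posCorr_typePlus (w : Sym2 (Fin n) → unitInterval) (x c : Fin n) {E₁ E₂ : Set (BondConfig (Fin n))}
    (hE₁ : ∀ ⦃ω ω' : BondConfig (Fin n)⦄,
      (⋃ s ∈ ({x} : Set (Fin n)), openEdgeCluster ω s) ⊆ (⋃ s ∈ ({x} : Set (Fin n)), openEdgeCluster ω' s) →
      (⋃ t ∈ ({c} : Set (Fin n)), openEdgeCluster ω' t) ⊆ (⋃ t ∈ ({c} : Set (Fin n)), openEdgeCluster ω t) →
      ω ∈ E₁ → ω' ∈ E₁)
    (hE₂ : ∀ ⦃ω ω' : BondConfig (Fin n)⦄,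
      (⋃ s ∈ ({x} : Set (Fin n)), openEdgeCluster ω s) ⊆ (⋃ s ∈ ({x} : Set (Fin n)), openEdgeCluster ω' s) →
      (⋃ t ∈ ({c} : Set (Fin n)), openEdgeCluster ω' t) ⊆ (⋃ t ∈ ({c} : Set (Fin n)), openEdgeCluster ω t) →
      ω ∈ E₂ → ω' ∈ E₂) :
    (prodBernoulli w).real ((openConn x c : Set (BondConfig (Fin n)))ᶜ ∩ E₁) *
        (prodBernoulli w).real ((openConn x c : Set (BondConfig (Fin n)))ᶜ ∩ E₂) ≤
      (prodBernoulli w).real ((openConn x c : Set (BondConfig (Fin n)))ᶜ ∩ (E₁ ∩ E₂)) *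
        (prodBernoulli w).real (openConn x c : Set (BondConfig (Fin n)))ᶜ := by
  have key := setTwoClusterExchange w ({x} : Set (Fin n)) ({c} : Set (Fin n))
    (A₁ := E₁) (A₂ := E₂) (B₁ := univ) (B₂ := univ) hE₁ hE₂
    (fun _ _ _ _ _ => mem_univ _) (fun _ _ _ _ _ => mem_univ _)
  rw [sep_singletons_eq x c] at key
  simpa only [inter_univ, univ_inter] using key

/-- **Conditioned championship exchange, general type-`(+)` event.**  If `S(x) ≤ S(c)` and `E` is of type `(+)` for
`(C_{{x}}, C_{{c}})`, then `μ(E ∩ {|π(x)| ≤ j}) ≤ μ(E ∩ {|π(c)| ≤ j})`. [this work] -/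
theorem exchange_typePlus (w : Sym2 (Fin n) → unitInterval) (A : Finset (Fin n)) (x c : Fin n) (j : ℕ)
    {E : Set (BondConfig (Fin n))}
    (hE : ∀ ⦃ω ω' : BondConfig (Fin n)⦄,
      (⋃ s ∈ ({x} : Set (Fin n)), openEdgeCluster ω s) ⊆ (⋃ s ∈ ({x} : Set (Fin n)), openEdgeCluster ω' s) →
      (⋃ t ∈ ({c} : Set (Fin n)), openEdgeCluster ω' t) ⊆ (⋃ t ∈ ({c} : Set (Fin n)), openEdgeCluster ω t) →
      ω ∈ E → ω' ∈ E)
    (hS : (prodBernoulli w).real {ω : BondConfig (Fin n) | (A.filter fun a => ω ∈ openConn x a).card ≤ j} ≤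
      (prodBernoulli w).real {ω : BondConfig (Fin n) | (A.filter fun a => ω ∈ openConn c a).card ≤ j}) :
    (prodBernoulli w).real (E ∩ {ω : BondConfig (Fin n) | (A.filter fun a => ω ∈ openConn x a).card ≤ j}) ≤
      (prodBernoulli w).real (E ∩ {ω : BondConfig (Fin n) | (A.filter fun a => ω ∈ openConn c a).card ≤ j}) := by
  set μ := prodBernoulli w with hμ
  set K : Set (BondConfig (Fin n)) := (openConn x c : Set (BondConfig (Fin n))) with hK
  set Lx : Set (BondConfig (Fin n)) := {ω | (A.filter fun a => ω ∈ openConn x a).card ≤ j} with hLx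
  set Lc : Set (BondConfig (Fin n)) := {ω | (A.filter fun a => ω ∈ openConn c a).card ≤ j} with hLc
  set Hx : Set (BondConfig (Fin n)) := {ω | j < (A.filter fun a => ω ∈ openConn x a).card} with hHx
  have hmeas : ∀ s : Set (BondConfig (Fin n)), MeasurableSet s := fun _ => MeasurableSet.of_discrete
  have hnn : ∀ s : Set (BondConfig (Fin n)), 0 ≤ μ.real s := fun _ => measureReal_nonneg
  -- on `K = {x ↔ c}` the two light events agree
  have hKeq : ∀ F : Set (BondConfig (Fin n)), F ∩ Lx ∩ K = F ∩ Lc ∩ K := by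
    intro F
    ext ω
    simp only [mem_inter_iff, hLx, hLc, mem_setOf_eq]
    constructor
    · rintro ⟨⟨hF, hl⟩, hk⟩; exact ⟨⟨hF, by rwa [← filter_eq_of_openConn A hk]⟩, hk⟩
    · rintro ⟨⟨hF, hl⟩, hk⟩; exact ⟨⟨hF, by rwa [filter_eq_of_openConn A hk]⟩, hk⟩
  -- splits along `K`
  have split : ∀ F : Set (BondConfig (Fin n)), μ.real F = μ.real (F ∩ K) + μ.real (F ∩ Kᶜ) := by
    intro F
    rw [← Set.sdiff_eq]
    exact (measureReal_inter_add_sdiff (μ := μ) (s := F) (t := K) (hmeas _)).symm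
  -- championship restricted to `Kᶜ`
  have hSD : μ.real (Kᶜ ∩ Lx) ≤ μ.real (Kᶜ ∩ Lc) := by
    have e1 := split Lx
    have e2 := split Lc
    have e3 : Lx ∩ K = Lc ∩ K := by simpa only [univ_inter] using hKeq univ
    rw [inter_comm Kᶜ Lx, inter_comm Kᶜ Lc]
    linarith [e3 ▸ e1]
  -- `Kᶜ = (Kᶜ ∩ Hx) ⊔ (Kᶜ ∩ Lx)` and `Kᶜ ∩ E = (Kᶜ ∩ E ∩ Hx) ⊔ (Kᶜ ∩ E ∩ Lx)`
  have hHL : ∀ F : Set (BondConfig (Fin n)), μ.real F = μ.real (F ∩ Hx) + μ.real (F ∩ Lx) := by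
    intro F
    have hc : F ∩ Lx = F \ Hx := by
      ext ω; simp only [mem_inter_iff, mem_sdiff, hLx, hHx, mem_setOf_eq, not_lt]
    rw [hc]
    exact (measureReal_inter_add_sdiff (μ := μ) (s := F) (t := Hx) (hmeas _)).symm
  -- the two positive correlations on `Kᶜ`
  have p1 := posCorr_typePlus w x c hE (heavy_typePlus A x c j)
  have p2 := posCorr_typePlus w x c hE (light_typePlus A x c j)
  -- the chain on `Kᶜ`
  have hD := hHL Kᶜ
  have hDE := hHL (Kᶜ ∩ E)
  have main : μ.real Kᶜ * μ.real (Kᶜ ∩ E ∩ Lx) ≤ μ.real Kᶜ * μ.real (Kᶜ ∩ E ∩ Lc) := by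
    have e1 : Kᶜ ∩ (E ∩ Hx) = Kᶜ ∩ E ∩ Hx := (inter_assoc _ _ _).symm
    have e2 : Kᶜ ∩ (E ∩ Lc) = Kᶜ ∩ E ∩ Lc := (inter_assoc _ _ _).symm
    rw [e1] at p1
    rw [e2] at p2
    nlinarith [hnn (Kᶜ ∩ E), hnn (Kᶜ ∩ Hx), hnn (Kᶜ ∩ Lx), hnn (Kᶜ ∩ Lc), hnn Kᶜ, hnn (Kᶜ ∩ E ∩ Hx),
      hnn (Kᶜ ∩ E ∩ Lx), hnn (Kᶜ ∩ E ∩ Lc)]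
  have hDc : μ.real (Kᶜ ∩ E ∩ Lx) ≤ μ.real (Kᶜ ∩ E ∩ Lc) := by
    by_cases h0 : μ.real Kᶜ = 0
    · have hz : μ.real (Kᶜ ∩ E ∩ Lx) = 0 :=
        le_antisymm (le_trans (measureReal_mono (show Kᶜ ∩ E ∩ Lx ⊆ Kᶜ from
          fun ω hω => hω.1.1) (measure_ne_top μ _)) h0.le) (hnn _)
      rw [hz]; exact hnn _
    · have hpos : 0 < μ.real Kᶜ := lt_of_le_of_ne (hnn _) (Ne.symm h0)
      exact le_of_mul_le_mul_left main hpos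
  -- assemble
  rw [split (E ∩ Lx), split (E ∩ Lc), hKeq E]
  have e3 : E ∩ Lx ∩ Kᶜ = Kᶜ ∩ E ∩ Lx := by rw [inter_comm, inter_assoc]
  have e4 : E ∩ Lc ∩ Kᶜ = Kᶜ ∩ E ∩ Lc := by rw [inter_comm, inter_assoc]
  rw [e3, e4]
  linarith

end ConditionedChampionExchange

open ConditionedChampionExchange

/-- **Conditioned championship exchange.**  For relays `x, c ∈ A`... (only `S(x) ≤ S(c)` is used) and any vertex `o`:
`μ({o ↔ x} ∩ {|π(x)| ≤ j}) ≤ μ({o ↔ x} ∩ {|π(c)| ≤ j})` — given that the observer reaches `x`, the champion `c` is still at least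
as likely to be light as `x` itself. [this work] -/
theorem conditionedChampionExchange (w : Sym2 (Fin n) → unitInterval) (A : Finset (Fin n)) (o x c : Fin n) (j : ℕ)
    (hS : (prodBernoulli w).real {ω : BondConfig (Fin n) | (A.filter fun a => ω ∈ openConn x a).card ≤ j} ≤
      (prodBernoulli w).real {ω : BondConfig (Fin n) | (A.filter fun a => ω ∈ openConn c a).card ≤ j}) :
    (prodBernoulli w).real ((openConn o x : Set (BondConfig (Fin n))) ∩
        {ω | (A.filter fun a => ω ∈ openConn x a).card ≤ j}) ≤
      (prodBernoulli w).real ((openConn o x : Set (BondConfig (Fin n))) ∩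
        {ω | (A.filter fun a => ω ∈ openConn c a).card ≤ j}) := by
  have hE : ∀ ⦃ω ω' : BondConfig (Fin n)⦄,
      (⋃ s ∈ ({x} : Set (Fin n)), openEdgeCluster ω s) ⊆ (⋃ s ∈ ({x} : Set (Fin n)), openEdgeCluster ω' s) →
      (⋃ t ∈ ({c} : Set (Fin n)), openEdgeCluster ω' t) ⊆ (⋃ t ∈ ({c} : Set (Fin n)), openEdgeCluster ω t) →
      ω ∈ (openConn o x : Set (BondConfig (Fin n))) → ω' ∈ (openConn o x : Set (BondConfig (Fin n))) := by
    intro ω ω' hs ht h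
    rw [KNPreFKG.openConn_symm o x] at h ⊢
    exact TwoSetExchange.typePlus_openConn_of_mem ({x} : Set (Fin n)) ({c} : Set (Fin n)) (mem_singleton x) o hs ht h
  exact exchange_typePlus w A x c j hE hS

/-- **Conditioned championship exchange, swap form.**  With `S(x) ≤ S(c)`:
`μ({o↔x} ∩ {|π(x)| ≤ j} ∩ {|π(c)| > j}) ≤ μ({o↔x} ∩ {|π(x)| > j} ∩ {|π(c)| ≤ j})` — the heavy block is moved from the champion to the
observer's relay. [this work] -/
theorem conditionedChampionExchange_swap (w : Sym2 (Fin n) → unitInterval) (A : Finset (Fin n)) (o x c : Fin n) (j : ℕ)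
    (hS : (prodBernoulli w).real {ω : BondConfig (Fin n) | (A.filter fun a => ω ∈ openConn x a).card ≤ j} ≤
      (prodBernoulli w).real {ω : BondConfig (Fin n) | (A.filter fun a => ω ∈ openConn c a).card ≤ j}) :
    (prodBernoulli w).real ((openConn o x : Set (BondConfig (Fin n))) ∩
        {ω | (A.filter fun a => ω ∈ openConn x a).card ≤ j} ∩ {ω | j < (A.filter fun a => ω ∈ openConn c a).card}) ≤
      (prodBernoulli w).real ((openConn o x : Set (BondConfig (Fin n))) ∩
        {ω | j < (A.filter fun a => ω ∈ openConn x a).card} ∩ {ω | (A.filter fun a => ω ∈ openConn c a).card ≤ j}) := by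
  set μ := prodBernoulli w with hμ
  set E : Set (BondConfig (Fin n)) := (openConn o x : Set (BondConfig (Fin n))) with hEdef
  set Lx : Set (BondConfig (Fin n)) := {ω | (A.filter fun a => ω ∈ openConn x a).card ≤ j} with hLx
  set Lc : Set (BondConfig (Fin n)) := {ω | (A.filter fun a => ω ∈ openConn c a).card ≤ j} with hLc
  set Hx : Set (BondConfig (Fin n)) := {ω | j < (A.filter fun a => ω ∈ openConn x a).card} with hHx
  set Hc : Set (BondConfig (Fin n)) := {ω | j < (A.filter fun a => ω ∈ openConn c a).card} with hHc
  have hmeas : ∀ s : Set (BondConfig (Fin n)), MeasurableSet s := fun _ => MeasurableSet.of_discrete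
  have key := conditionedChampionExchange w A o x c j hS
  -- `μ(E ∩ Lx) = μ(E ∩ Lx ∩ Lc) + μ(E ∩ Lx ∩ Hc)` and `μ(E ∩ Lc) = μ(E ∩ Lx ∩ Lc) + μ(E ∩ Hx ∩ Lc)`
  have h1 : μ.real (E ∩ Lx) = μ.real (E ∩ Lx ∩ Lc) + μ.real (E ∩ Lx ∩ Hc) := by
    have hc : E ∩ Lx ∩ Hc = (E ∩ Lx) \ Lc := by
      ext ω; simp only [mem_inter_iff, mem_sdiff, hLc, hHc, mem_setOf_eq, not_le]
    rw [hc]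
    exact (measureReal_inter_add_sdiff (μ := μ) (s := E ∩ Lx) (t := Lc) (hmeas _)).symm
  have h2 : μ.real (E ∩ Lc) = μ.real (E ∩ Lx ∩ Lc) + μ.real (E ∩ Hx ∩ Lc) := by
    have hc : E ∩ Hx ∩ Lc = (E ∩ Lc) \ Lx := by
      ext ω; simp only [mem_inter_iff, mem_sdiff, hLx, hHx, mem_setOf_eq, not_le]; tauto
    have hd : E ∩ Lx ∩ Lc = (E ∩ Lc) ∩ Lx := by
      ext ω; simp only [mem_inter_iff]; tauto
    rw [hc, hd]
    exact (measureReal_inter_add_sdiff (μ := μ) (s := E ∩ Lc) (t := Lx) (hmeas _)).symm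
  change μ.real (E ∩ Lx) ≤ μ.real (E ∩ Lc) at key
  linarith

/-- **Moment exchange at a champion** (sum of the swap form over `x ≠ c`): if `c ∈ A` is a level-`j` champion
(`S(a) ≤ S(c)` for all `a ∈ A`), then
`Σ_{x ∈ A∖c} μ({o↔x} ∩ {|π(x)| ≤ j} ∩ {|π(c)| > j}) ≤ Σ_{x ∈ A∖c} μ({o↔x} ∩ {|π(x)| > j} ∩ {|π(c)| ≤ j})`, i.e.
`E[N; 1 ≤ N ≤ j, c heavy] ≤ E[N; N > j, c light]` with `N = |π(o)|`. [this work] -/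
theorem momentExchange (w : Sym2 (Fin n) → unitInterval) (A : Finset (Fin n)) (o c : Fin n) (j : ℕ)
    (hchamp : ∀ a ∈ A,
      (prodBernoulli w).real {ω : BondConfig (Fin n) | (A.filter fun z => ω ∈ openConn a z).card ≤ j} ≤
        (prodBernoulli w).real {ω : BondConfig (Fin n) | (A.filter fun z => ω ∈ openConn c z).card ≤ j}) :
    ∑ x ∈ A.erase c, (prodBernoulli w).real ((openConn o x : Set (BondConfig (Fin n))) ∩
        {ω | (A.filter fun a => ω ∈ openConn x a).card ≤ j} ∩ {ω | j < (A.filter fun a => ω ∈ openConn c a).card}) ≤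
      ∑ x ∈ A.erase c, (prodBernoulli w).real ((openConn o x : Set (BondConfig (Fin n))) ∩
        {ω | j < (A.filter fun a => ω ∈ openConn x a).card} ∩ {ω | (A.filter fun a => ω ∈ openConn c a).card ≤ j}) :=
  Finset.sum_le_sum fun x hx => conditionedChampionExchange_swap w A o x c j (hchamp x (Finset.mem_of_mem_erase hx))

end Summit.CriticalPhenomena.PercolationContinuityZ3.Theorems

end
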